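import Summits.Ventures.PercRepro.RankLevelSetExplicitLin2KeyL

/-!
# PercRepro — THE LEVEL-16 THEOREM-M ROW OF C-025 OVER THE 5/8 RANGE: THE KEY AT `p = 41 686` (p9, S4; the key is p4's)

`proofs/SUBCLAIM-S4-p9.md` §S4.2⁗⁗. p4's THEOREM-M key `KeyL 16 p d` (RankLevelSetExplicitLin2KeyL) checked by the kernel at
`p = 41 686` on the coranks `17 ≤ d ≤ 40976` of THE 5/8 RANGE (`D' = 16 + 5·2^{13} = 40976`; the large-corank theorem
`c025_core_explicit_large_of58` takes the coranks beyond): `41 686` = the least `p` with the optimal Chernoff pair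
`16·n^n ≤ 2^n·(n − K)^{n−K}·K^K` at `n = p + D'`, `K = 16 + D'` (twin lean-drafts/p9/g7/twin/range58.py), at or above the key's
own floor and the bases `N₁ = 41 196`, `P₂ = 41 010` (RankLevelSetExplicitLin2Bases58); p4's sharp row sits at `66 440`
(RankLevelSetExplicitLin2IndepFloorS). The level step and the unconditional chain are RankLevelSetExplicitLin2IndepFloor58.
Axioms: standard (kernel `decide`).
-/
-- part B: chunks 9 … 16 of 20

namespace PercRepro

namespace ThmN

namespace Explicit

/-- The THEOREM-M key row at `(q, p) = (16, 41 686)`, chunk 9 of 20: coranks `16401 … 18448`, by the kernel. -/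
theorem key_sixteen_indep58_row_9 : ∀ t < 2048, KeyL 16 41686 (17 + (16384 + t)) := by decide +kernel

/-- The THEOREM-M key row at `(q, p) = (16, 41 686)`, chunk 10 of 20: coranks `18449 … 20496`, by the kernel. -/
theorem key_sixteen_indep58_row_10 : ∀ t < 2048, KeyL 16 41686 (17 + (18432 + t)) := by decide +kernel

/-- The THEOREM-M key row at `(q, p) = (16, 41 686)`, chunk 11 of 20: coranks `20497 … 22544`, by the kernel. -/
theorem key_sixteen_indep58_row_11 : ∀ t < 2048, KeyL 16 41686 (17 + (20480 + t)) := by decide +kernel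

/-- The THEOREM-M key row at `(q, p) = (16, 41 686)`, chunk 12 of 20: coranks `22545 … 24592`, by the kernel. -/
theorem key_sixteen_indep58_row_12 : ∀ t < 2048, KeyL 16 41686 (17 + (22528 + t)) := by decide +kernel

/-- The THEOREM-M key row at `(q, p) = (16, 41 686)`, chunk 13 of 20: coranks `24593 … 26640`, by the kernel. -/
theorem key_sixteen_indep58_row_13 : ∀ t < 2048, KeyL 16 41686 (17 + (24576 + t)) := by decide +kernel

/-- The THEOREM-M key row at `(q, p) = (16, 41 686)`, chunk 14 of 20: coranks `26641 … 28688`, by the kernel. -/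
theorem key_sixteen_indep58_row_14 : ∀ t < 2048, KeyL 16 41686 (17 + (26624 + t)) := by decide +kernel

/-- The THEOREM-M key row at `(q, p) = (16, 41 686)`, chunk 15 of 20: coranks `28689 … 30736`, by the kernel. -/
theorem key_sixteen_indep58_row_15 : ∀ t < 2048, KeyL 16 41686 (17 + (28672 + t)) := by decide +kernel

/-- The THEOREM-M key row at `(q, p) = (16, 41 686)`, chunk 16 of 20: coranks `30737 … 32784`, by the kernel. -/
theorem key_sixteen_indep58_row_16 : ∀ t < 2048, KeyL 16 41686 (17 + (30720 + t)) := by decide +kernel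

end Explicit

end ThmN

end PercRepro
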